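import Mathlib
import Summits.ValiantsHypothesis.ValiantsHypothesis.Theorems.TriangularDimersDivisionEasy.Negative.LowerBound

/-!
# Crux `DivisionGap.ZeroOneTransfer` (stmt-ValiantsHypothesis-5066), line `charged-uncharged` —
stub `stub_blockComplementCover` (D2, THE COMPLEMENT OF AN ALIGNED EVEN BLOCK HAS A DIMER COVER)

For even `n`, `m` and an aligned block `B = [p m, p m + m) × [q m, q m + m)` of the rhombus `R_n`
(vertices `Fin n × Fin n`, triangular-lattice adjacency `Adj`), the horizontal-domino cover
`rowCover : (i, j) ↦ (i, partner j)` (`partner j = j + 1` for even `j`, `j - 1` for odd `j`) is, on the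
complement of `B`, a fixed-point-free involution along lattice edges which stays in the complement:
it preserves the row, and since `q m` and `q m + m` are even the column pair `{2k, 2k+1}` containing a
column outside `[q m, q m + m)` lies entirely outside it.  Involution / no fixed point / adjacency are
`rowCover_mem_dimers`.  The neighbouring stub `stub_blockRestriction` consumes the resulting `∃ g, …`.
[folklore]
-/

open MvPolynomial
open Literature.Computability.AlgebraicComplexity
open Summit.ValiantsHypothesis.ValiantsHypothesis.Theorems.TriangularDimersDivisionEasy.Negative
open scoped NNReal BigOperators
set_option linter.dupNamespace false
noncomputable section

namespace Summit.ValiantsHypothesis.ValiantsHypothesis.Theorems.DivisionGapZeroOneTransfer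

namespace BlockComplementCover

variable {n : ℕ}

/-- The horizontal-domino cover is a fixed-point-free involution along lattice edges. [folklore] -/
theorem rowCover_isDimer (hn : Even n) : IsDimer (rowCover hn) := by
  have h := rowCover_mem_dimers hn
  rw [dimers, Finset.mem_filter] at h
  exact h.2

/-- The horizontal-domino cover preserves the row. [folklore] -/
theorem rowCover_fst (hn : Even n) (v : Vtx n) : (rowCover hn v).1 = v.1 := rfl

/-- The horizontal-domino cover moves the column to its partner. [folklore] -/
theorem rowCover_snd (hn : Even n) (v : Vtx n) : (rowCover hn v).2 = partner hn v.2 := rfl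

/-- For even `m`, the partner of a column outside `[q m, q m + m)` is outside `[q m, q m + m)`:
both end points are even, so the pair `{2k, 2k + 1}` never straddles them. [folklore] -/
theorem partner_not_mem_of_not_mem (hn : Even n) {m : ℕ} (hm : Even m) (q : ℕ) (j : Fin n)
    (hj : ¬ (q * m ≤ (j : ℕ) ∧ (j : ℕ) < q * m + m)) :
    ¬ (q * m ≤ ((partner hn j : Fin n) : ℕ) ∧ ((partner hn j : Fin n) : ℕ) < q * m + m) := by
  have hm2 : m % 2 = 0 := Nat.even_iff.mp hm
  have hqm : (q * m) % 2 = 0 := Nat.even_iff.mp (Nat.even_mul.mpr (Or.inr hm))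
  by_cases h : (j : ℕ) % 2 = 0
  · rw [partner_val_of_even hn h]
    omega
  · rw [partner_val_of_odd hn h]
    omega

end BlockComplementCover

open BlockComplementCover in
/-- **Stub D2 — THE COMPLEMENT OF AN ALIGNED EVEN BLOCK HAS A DIMER COVER** (horizontal dominoes
`(i, 2k) – (i, 2k+1)`: for even `m` the block's column range is a union of such pairs). [folklore] -/
theorem stub_blockComplementCover :
    ∀ (n m p q : ℕ), Even n → Even m → p * m + m ≤ n → q * m + m ≤ n →
      ∃ g : Fin n × Fin n → Fin n × Fin n, ∀ v : Fin n × Fin n,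
        ¬ ((p * m ≤ (v.1 : ℕ) ∧ (v.1 : ℕ) < p * m + m) ∧ (q * m ≤ (v.2 : ℕ) ∧ (v.2 : ℕ) < q * m + m)) →
          g (g v) = v ∧ g v ≠ v ∧ Adj v (g v) ∧
          ¬ ((p * m ≤ ((g v).1 : ℕ) ∧ ((g v).1 : ℕ) < p * m + m) ∧
             (q * m ≤ ((g v).2 : ℕ) ∧ ((g v).2 : ℕ) < q * m + m)) := by
  intro n m p q hn hm _ _
  refine ⟨rowCover hn, fun v hv => ?_⟩
  obtain ⟨h1, h2, h3⟩ := rowCover_isDimer hn v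
  refine ⟨h1, h2, h3, ?_⟩
  rw [rowCover_fst, rowCover_snd]
  -- either the row is already outside the block's row range, or the column is outside its column
  -- range and then so is its partner
  by_cases hrow : p * m ≤ (v.1 : ℕ) ∧ (v.1 : ℕ) < p * m + m
  · have hcol : ¬ (q * m ≤ (v.2 : ℕ) ∧ (v.2 : ℕ) < q * m + m) := fun hcol => hv ⟨hrow, hcol⟩
    exact fun h => partner_not_mem_of_not_mem hn hm q v.2 hcol h.2
  · exact fun h => hrow h.1

end Summit.ValiantsHypothesis.ValiantsHypothesis.Theorems.DivisionGapZeroOneTransfer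

end
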